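import Mathlib
import Summits.Ventures.PercRepro2.Defs
import Summits.Ventures.PercRepro2.Independence
import Summits.Ventures.PercRepro2.Harris
import Summits.Ventures.PercRepro2.Graph
import Summits.Ventures.PercRepro2.Exploration
import Summits.Ventures.PercRepro2.Events
import Summits.Ventures.PercRepro2.FourFunctions
import Summits.Ventures.PercRepro2.Induced
import Summits.Ventures.PercRepro2.Frontier
import Summits.Ventures.PercRepro2.ObsIndependence
import Summits.Ventures.PercRepro2.BHK
import Summits.Ventures.PercRepro2.BHKEvents
import Summits.Ventures.PercRepro2.OrderPreservation
import Summits.Ventures.PercRepro2.BHKAvoid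
import Summits.Ventures.PercRepro2.SameClusterAvoid
import Summits.Ventures.PercRepro2.CaseOneRegime
import Summits.Ventures.PercRepro2.CaseOnePos
import Summits.Ventures.PercRepro2.CaseOneJ11
import Summits.Ventures.PercRepro2.CaseOneRV
import Summits.Ventures.PercRepro2.CaseOnePendant
import Summits.Ventures.PercRepro2.CaseOnePendantAny
import Summits.Ventures.PercRepro2.CaseOnePendantAnyI
import Summits.Ventures.PercRepro2.CaseOnePendantNec

/-!
# The Q-threshold form is necessary, `(i)`-side: `(i)` on every pendant extension forces `(i-Q)`
(blind cell PercRepro2, p1 g13; the mirror of `CaseOnePendantNec.lean`)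

`iExprT_update_of_leaf_at` (`iExprT` at `v` ignores the leaf weight), `iExpr_update_leaf_at`
(`iExpr(a₃)` at leaf weight `t` = `t · ((1 − t) · (i-Q)(v) + t · (i)(v))`, cleared) and
**`zSplitIQ_of_leaf_at_all`**: `(i)(a₃)` for every `t ∈ (0, 1]` ⟹ `(i-Q)(v)`. With `zSplitI_of_leaf_at`:
«`(i)` on all pendant extensions of `(G′, v)` ⟺ `(i)(v) ∧ (i-Q)(v)`». Nothing beyond the equivalence is
claimed. -/

namespace Summit.Ventures.PercRepro2

namespace CaseOne

section LeafInvarianceI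
variable {V : Type*} {E : Type*} [Fintype E] [DecidableEq E] {R : Type*} [CommRing R]
variable {ends : E → Sym2 V} {v a₃ : V} {e₀ : E}

/-- `iExprT` at `v` ignores the weight of the leaf edge. -/
lemma iExprT_update_of_leaf_at (p : E → R) (hl : IsLeafAt ends v a₃ e₀) (t : R) {o a₁ a₂ b : V}
    (ho : o ≠ a₃) (h1 : a₁ ≠ a₃) (h2 : a₂ ≠ a₃) (hb : b ≠ a₃) (c₀ c₁ : R) :
    iExprT (Function.update p e₀ t) ends o a₁ a₂ v b c₀ c₁ = iExprT p ends o a₁ a₂ v b c₀ c₁ := by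
  have hv : v ≠ a₃ := hl.ne
  have hQ := indicator_compl_ignore (R := R)
    (fun ω c => connEvent_indicator_update_of_leaf hl ω c h1 h2)
  have hB := fun ω c => connEvent_indicator_update_of_leaf (R := R) hl ω c h1 hb
  have hV := fun ω c => connEvent_indicator_update_of_leaf (R := R) hl ω c h1 hv
  have hO := fun ω c => connEvent_indicator_update_of_leaf (R := R) hl ω c h2 ho
  rw [iExprT_eq, iExprT_eq, probQ_update_of_leaf_at p hl t h1 h2,
    prob_update_of_ignore p e₀ t _ (indicator_inter_ignore (indicator_inter_ignore
      (indicator_inter_ignore hB hV) hO) hQ),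
    prob_update_of_ignore p e₀ t _ (indicator_inter_ignore hB hQ),
    prob_update_of_ignore p e₀ t _ (indicator_inter_ignore (indicator_inter_ignore hV hO) hQ),
    prob_update_of_ignore p e₀ t _ (indicator_inter_ignore (indicator_inter_ignore hB hV) hQ),
    prob_update_of_ignore p e₀ t _ (indicator_inter_ignore hV hQ)]

end LeafInvarianceI

section NecessityI
variable {V : Type*} {E : Type*} [Fintype E] [DecidableEq E] {R : Type*} [Field R] [LinearOrder R]
  [IsStrictOrderedRing R]
variable {ends : E → Sym2 V} {v a₃ : V} {e₀ : E}

omit [LinearOrder R] [IsStrictOrderedRing R] in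
/-- **`(i)(a₃)` at the leaf weight `t` is `t · ((1 − t) · (i-Q)(v) + t · (i)(v))`** (cleared forms). -/
theorem iExpr_update_leaf_at (p : E → R) (hl : IsLeafAt ends v a₃ e₀) (t : R) (o a₁ a₂ b : V)
    (ho : o ≠ a₃) (h1 : a₁ ≠ a₃) (h2 : a₂ ≠ a₃) (hb : b ≠ a₃) :
    iExpr (Function.update p e₀ t) ends o a₁ a₂ a₃ b =
      t * ((1 - t) * iExprT p ends o a₁ a₂ v b (Dqo p ends o a₁ a₂) (prob p (connEvent ends a₁ a₂)ᶜ) +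
        t * iExpr p ends o a₁ a₂ v b) := by
  rw [iExpr_eq_of_leaf_at (Function.update p e₀ t) hl o a₁ a₂ b ho h1 h2 hb,
    Dpd_leaf_at (Function.update p e₀ t) hl a₁ a₂ h1 h2,
    Dpdo_leaf_at (Function.update p e₀ t) hl o a₁ a₂ ho h1 h2, Function.update_self, iExprT_mix,
    iExprT_update_of_leaf_at p hl t ho h1 h2 hb, iExprT_update_of_leaf_at p hl t ho h1 h2 hb,
    probQ_update_of_leaf_at p hl t h1 h2, Dqo_update_of_leaf_at p hl t ho h1 h2,
    Dpd_update_of_leaf_at p hl t h1 h2, Dpdo_update_of_leaf_at p hl t ho h1 h2, iExpr_eq_iExprT]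

/-- **`(i-Q)` is necessary**: if `(i)(a₃)` holds for every weight `t ∈ (0, 1]` of the leaf edge at `v`,
then `(i-Q)(v)` holds. -/
theorem zSplitIQ_of_leaf_at_all (p : E → R) (hl : IsLeafAt ends v a₃ e₀) (o a₁ a₂ b : V)
    (ho : o ≠ a₃) (h1 : a₁ ≠ a₃) (h2 : a₂ ≠ a₃) (hb : b ≠ a₃)
    (h : ∀ t : R, 0 < t → t ≤ 1 → ZSplitI (Function.update p e₀ t) ends o a₁ a₂ a₃ b) :
    ZSplitIQ p ends o a₁ a₂ v b := by
  unfold ZSplitIQ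
  set X := iExprT p ends o a₁ a₂ v b (Dqo p ends o a₁ a₂) (prob p (connEvent ends a₁ a₂)ᶜ) with hX
  set Y := iExpr p ends o a₁ a₂ v b with hY
  have key : ∀ t : R, 0 < t → t ≤ 1 → 0 ≤ (1 - t) * X + t * Y := by
    intro t ht0 ht1
    have := h t ht0 ht1
    unfold ZSplitI at this
    rw [iExpr_update_leaf_at p hl t o a₁ a₂ b ho h1 h2 hb] at this
    exact nonneg_of_mul_nonneg_right (by linarith) ht0
  have hY0 : 0 ≤ Y := by
    have := key 1 one_pos le_rfl
    linarith
  by_contra hX0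
  have hX0 : X < 0 := lt_of_not_ge hX0
  -- `t₀ = −X / (2 (Y − X)) ∈ (0, 1]` gives `(1 − t₀) X + t₀ Y = X / 2 < 0`
  have hYX : 0 < Y - X := by linarith
  set t₀ : R := -X / (2 * (Y - X)) with ht₀
  have ht0 : 0 < t₀ := by
    rw [ht₀]
    exact div_pos (by linarith) (by linarith)
  have ht1 : t₀ ≤ 1 := by
    rw [ht₀, div_le_one (by linarith)]
    linarith
  have hval : (1 - t₀) * X + t₀ * Y = X / 2 := by
    rw [ht₀]
    field_simp
    ring
  have := key t₀ ht0 ht1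
  rw [hval] at this
  linarith

end NecessityI

end CaseOne

end Summit.Ventures.PercRepro2
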